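import Literature.Analysis.FluidPDE.HardSphereFlowConstruction
import Literature.Analysis.FluidPDE.HardSphereRegularGeometry
import Literature.Analysis.FluidPDE.HardSphereDynamicsProofs
import HarnessLib

/-!
# Orbits of the collision-by-collision hard-sphere flow are hard-sphere trajectories

Third layer of the plan for Alexander's theorem on `T^d`
(`Kinetic.HardSphereFlow.nonempty_torus`, reduced in
`Literature.Analysis.FluidPDE.HardSphereFlowConstruction` to five named facts about the explicit
flow `Kinetic.Alexander.flow` and its good set `Kinetic.Alexander.good`). This file discharges
the fact `Kinetic.Alexander.torusFlow_isTrajectory` — *orbits of good points are hard-sphere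
trajectories* (Cercignani–Illner–Pulvirenti 1994 §4.2 p. 65: on `Γ₀` "Eqs. (2.1), (2.2) and
the free flow determine completely the time evolution"; Gallagher–Saint-Raymond–Texier 2013
§4.1, Def. 4.1.2) — for every *regular* geometry (`Kinetic.Geometry.IsHardSphereRegular`,
`Literature.Analysis.FluidPDE.HardSphereRegularGeometry`), and specialises it to the torus with
`0 < ε < 1/2` (`Kinetic.Alexander.torusFlow_isTrajectory_holds`).

Contents (namespace `Kinetic.Alexander`):

* exit times in a regular geometry: `freeExitTime_le_of_frequently`,
  `freeExitTime_eq_zero_of_isIncoming` (an incoming contact pair forces `τ = 0`),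
  `freeExitTime_pos` (no incoming contact pair gives `τ > 0`), `freeFlight_freeExitTime_mem`
  (the exit configuration is in the closed domain), `exists_isIncoming_freeFlight_freeExitTime`
  (it has an incoming contact pair);
* `IsSimpleIncomingWith G ε z p` — `IsSimpleIncoming` with the colliding pair `p` named — and
  its API (`incomingPairs_eq : incomingPairs G ε z = {p}`, so that `collisionStep` involves no
  choice: `collisionStep_eq_collidePair`; after the collision every contact pair is outgoing and
  the exit time is positive, `freeExitTime_collidePair_pos`);
* bookkeeping of the segments `[t_k, t_{k+1})` of the forward flow (`collisionCount_eq_of_segment`,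
  `fwdFlow_eq_of_segment`, `fwdFlowLeft_eq_of_segment`), valid for any datum;
* the forward orbit of a *forward-good* datum (`FwdGood`): states stay in the domain, instants
  are strictly increasing from index `1` and do not accumulate (`exists_segment`), the values at
  the instants (`fwdFlow_collisionInstant`, `fwdFlowLeft_collisionInstant_succ`), the set
  `instantSet` of real collision instants and the **jump relation** `exists_jump`
  (`Φ_t = collidePair p Φ_{t⁻}` with `Φ_{t⁻}` simple incoming), positions of `Φ_{t⁻}` and `Φ_t`
  agree, contacts happen only at instants (no grazing touch), free flight between instants,
  local finiteness, and the four one-sided limits (`Φ` is right-continuous with left limits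
  `Φ_{t⁻}`, `Φ_{·⁻}` is left-continuous with right limits `Φ`);
* the two-sided orbit of a good datum `z` (forward orbit of `z` for `t ≥ 0`, flipped
  left-continuous forward orbit of `flipVel z` for `t ≤ 0`, CIP 1994 (2.3)): collision times,
  one-sided limits, continuity of positions, free flight on collision-free windows, and the
  binary-collision clause, assembled into `isHardSphereTrajectory_flow`.

## Mathlib / Literature reuse

Everything about the construction (`freeExitTime`, `collisionStep`, `stateAfter`,
`collisionInstant`, `collisionCount(Before)`, `fwdFlow(Left)`, `flow`, `FwdGood`, `good`) is
`HardSphereFlowConstruction`'s; the near-contact analysis (`eventually_freeFlight_mem`,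
`eventually_freeFlight_not_mem`, symmetry of `IsIncoming`/`collidePair` in the pair) is
`HardSphereRegularGeometry`'s; `mem_contactSet_congr_fst`, `flipVel_mem_contactSet_iff`,
`continuous_flipVel`, `freeFlight_flipVel_freeFlight` are `HardSphereDynamicsProofs`'.
`ENNReal.tendsto_nat_tsum` (non-accumulation `∑ τ(z_k) = ∞` gives `t_k → ∞`), `Nat.find`,
`csSup` on `ℕ`, `tendsto_neg_nhdsLT/GT`, `continuousAt_iff_continuous_left'_right'` are
Mathlib's. No statement here has a Mathlib counterpart (Mathlib has no billiard flow).

## Design choices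

* All results are proved for an arbitrary regular geometry on a topological position space (no
  Hausdorff or measurability assumption is needed for this fact); the torus statement is the
  last line.
* Times of the construction live in `ℝ≥0∞`; a segment is described by the two inequalities
  `t_k ≤ ENNReal.ofReal u < t_{k+1}` (resp. `t_k < ENNReal.ofReal u ≤ t_{k+1}` for the
  left-continuous flow, with the variant `k = 0` covering an initial instant collision
  `τ(y) = 0`, which does occur for the flipped datum of a good point in contact).
* The backward half of an orbit is read off the *forward* orbit of `flipVel z` through the four
  one-sided limit lemmas, so that the forward kit is used twice and no separate backward
  analysis is needed.

## References

* C. Cercignani, R. Illner, M. Pulvirenti, *The Mathematical Theory of Dilute Gases*, Springer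
  (1994), §4.2 p. 65 (the flow `T^t` on `Γ₀`), eq. (2.3), Appendix 4.A pp. 107–111.
* I. Gallagher, L. Saint-Raymond, B. Texier, *From Newton to Boltzmann: hard spheres and
  short-range potentials*, EMS (2013), §4.1, Def. 4.1.2, Prop. 4.1.1 (p. 19: pathological
  trajectories).
* R. K. Alexander, *The infinite hard sphere system*, PhD thesis, UC Berkeley (1975).
-/

open Set Filter Topology Function
open scoped ENNReal

namespace Literature.Analysis.FluidPDE

noncomputable section

section Kinetic

variable {d : Type*} [Fintype d] {X : Type*} {N : ℕ}

namespace Alexander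

variable {G : Geometry d X} {ε : ℝ}

/-! ## Exit times: elementary bounds -/

/-- If the free flight is outside the domain at a time `t ≥ 0`, the exit time is at most `t`. [folklore] -/
theorem freeExitTime_le_of_not_mem {z : Config N d X} {t : ℝ} (ht : 0 ≤ t)
    (h : freeFlight G t z ∉ hardSphereDomain G N ε) : freeExitTime G ε z ≤ ENNReal.ofReal t :=
  sInf_le ⟨ENNReal.ofReal_ne_top, by rwa [ENNReal.toReal_ofReal ht]⟩

/-- If the free flight stays in the domain at all times `t ≥ 0` with `t < c`, the exit time is
at least `c`. [folklore] -/
theorem le_freeExitTime_of_forall_mem {z : Config N d X} {c : ℝ≥0∞}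
    (h : ∀ t : ℝ, 0 ≤ t → ENNReal.ofReal t < c → freeFlight G t z ∈ hardSphereDomain G N ε) :
    c ≤ freeExitTime G ε z := by
  refine le_sInf ?_
  rintro b ⟨hb, hmem⟩
  by_contra hlt
  refine hmem (h _ ENNReal.toReal_nonneg ?_)
  rw [ENNReal.ofReal_toReal hb]
  exact not_le.1 hlt

/-- If the free flight is outside the domain at times arbitrarily close to `r ≥ 0` from the
right, the exit time is at most `r`. [folklore] -/
theorem freeExitTime_le_of_frequently {z : Config N d X} {r : ℝ} (hr : 0 ≤ r)
    (h : ∃ᶠ t in 𝓝[>] r, freeFlight G t z ∉ hardSphereDomain G N ε) :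
    freeExitTime G ε z ≤ ENNReal.ofReal r := by
  by_contra hlt
  rw [not_le, ENNReal.lt_iff_exists_add_pos_lt] at hlt
  obtain ⟨δ, hδ, hδlt⟩ := hlt
  have hev : ∀ᶠ t in 𝓝[>] r, t ∈ Ioo r (r + δ) := Ioo_mem_nhdsGT (by simpa using hδ)
  obtain ⟨t, ht, htI⟩ := (h.and_eventually hev).exists
  refine ht (freeFlight_mem_hardSphereDomain_of_lt (hr.trans htI.1.le) (lt_of_le_of_lt ?_ hδlt))
  calc ENNReal.ofReal t = ENNReal.ofReal (r + (t - r)) := by rw [add_sub_cancel]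
    _ ≤ ENNReal.ofReal r + ENNReal.ofReal (t - r) := ENNReal.ofReal_add_le
    _ ≤ ENNReal.ofReal r + δ := by
        gcongr
        rw [← ENNReal.ofReal_coe_nnreal]
        exact ENNReal.ofReal_le_ofReal (by linarith [htI.2])

section Regular

variable [TopologicalSpace X]

/-- **An incoming contact pair forces an immediate exit**: `τ(z) = 0` (regular geometry). [folklore] -/
theorem freeExitTime_eq_zero_of_isIncoming (hG : G.IsHardSphereRegular ε) {z : Config N d X}
    {i j : Fin N} (hij : i ≠ j) (hc : z ∈ contactSet G N ε i j) (hin : IsIncoming G z i j) :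
    freeExitTime G ε z = 0 := by
  have h := freeExitTime_le_of_frequently (G := G) (ε := ε) le_rfl
    (hG.eventually_freeFlight_not_mem hij hc hin).frequently
  rwa [ENNReal.ofReal_zero, nonpos_iff_eq_zero] at h

/-- **No incoming contact pair gives a positive exit time**: if `z ∈ D_ε^N` and none of its
contact pairs is incoming then `τ(z) > 0` (regular geometry). [folklore] -/
theorem freeExitTime_pos (hG : G.IsHardSphereRegular ε) {z : Config N d X}
    (hz : z ∈ hardSphereDomain G N ε)
    (h : ∀ i j : Fin N, i ≠ j → z ∈ contactSet G N ε i j → ¬IsIncoming G z i j) :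
    0 < freeExitTime G ε z := by
  obtain ⟨δ, hδ, hmem⟩ : ∃ δ : ℝ, 0 < δ ∧ ∀ t : ℝ, 0 ≤ t → t < δ →
      freeFlight G t z ∈ hardSphereDomain G N ε := by
    have hev := hG.eventually_freeFlight_mem hz h
    obtain ⟨u, hu, hsub⟩ := mem_nhdsGE_iff_exists_Ico_subset.1 hev
    exact ⟨u, hu, fun t ht htu => hsub ⟨ht, htu⟩⟩
  refine lt_of_lt_of_le (ENNReal.ofReal_pos.2 hδ) (le_freeExitTime_of_forall_mem fun t ht htδ => ?_)
  exact hmem t ht ((ENNReal.ofReal_lt_ofReal_iff hδ).1 htδ)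

/-- **The exit configuration lies in the domain**: if `z ∈ D_ε^N` and `τ(z) < ∞` then
`S_{τ(z)} z ∈ D_ε^N` (the domain of a regular geometry is closed). [folklore] -/
theorem freeFlight_freeExitTime_mem (hG : G.IsHardSphereRegular ε) {z : Config N d X}
    (hz : z ∈ hardSphereDomain G N ε) (hτ : freeExitTime G ε z ≠ ∞) :
    freeFlight G (freeExitTime G ε z).toReal z ∈ hardSphereDomain G N ε := by
  rcases (ENNReal.toReal_nonneg : 0 ≤ (freeExitTime G ε z).toReal).eq_or_lt with h0 | h0
  · rw [← h0, freeFlight_zero]; exact hz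
  have hc : Continuous fun t : ℝ => freeFlight G t z := hG.continuous_freeFlight z
  refine hG.isClosed_hardSphereDomain.mem_of_tendsto
    ((hc.tendsto _).mono_left (nhdsWithin_le_nhds (s := Iio (freeExitTime G ε z).toReal))) ?_
  filter_upwards [Ioo_mem_nhdsLT h0] with t ht
  refine freeFlight_mem_hardSphereDomain_of_lt ht.1.le ?_
  calc ENNReal.ofReal t < ENNReal.ofReal (freeExitTime G ε z).toReal :=
        (ENNReal.ofReal_lt_ofReal_iff h0).2 ht.2
    _ = freeExitTime G ε z := ENNReal.ofReal_toReal hτ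

/-- **The exit configuration has an incoming contact pair**: if `z ∈ D_ε^N` and `τ(z) < ∞`, some
pair is in contact with incoming velocities in `S_{τ(z)} z` (otherwise the free flight would stay
in the domain a while longer, `eventually_freeFlight_mem`). [folklore] -/
theorem exists_isIncoming_freeFlight_freeExitTime (hG : G.IsHardSphereRegular ε)
    {z : Config N d X} (hz : z ∈ hardSphereDomain G N ε) (hτ : freeExitTime G ε z ≠ ∞) :
    ∃ i j : Fin N, i ≠ j ∧ freeFlight G (freeExitTime G ε z).toReal z ∈ contactSet G N ε i j ∧
      IsIncoming G (freeFlight G (freeExitTime G ε z).toReal z) i j := by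
  by_contra hno
  set r := (freeExitTime G ε z).toReal with hr
  have hw := freeFlight_freeExitTime_mem hG hz hτ
  have hpos := freeExitTime_pos hG hw fun i j hij hc hin => hno ⟨i, j, hij, hc, hin⟩
  have hle : ENNReal.ofReal r + freeExitTime G ε (freeFlight G r z) ≤ freeExitTime G ε z := by
    refine le_freeExitTime_of_forall_mem fun t ht htc => ?_
    rcases lt_or_ge t r with htr | hrt
    · refine freeFlight_mem_hardSphereDomain_of_lt ht ?_
      calc ENNReal.ofReal t < ENNReal.ofReal r := (ENNReal.ofReal_lt_ofReal_iff (ht.trans_lt htr)).2 htr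
        _ = freeExitTime G ε z := ENNReal.ofReal_toReal hτ
    · have hsplit : freeFlight G t z = freeFlight G (t - r) (freeFlight G r z) := by
        rw [← freeFlight_add, sub_add_cancel]
      rw [hsplit]
      refine freeFlight_mem_hardSphereDomain_of_lt (sub_nonneg.2 hrt) ?_
      have ht' : ENNReal.ofReal t = ENNReal.ofReal r + ENNReal.ofReal (t - r) := by
        rw [← ENNReal.ofReal_add ENNReal.toReal_nonneg (sub_nonneg.2 hrt), add_sub_cancel]
      rw [ht', ENNReal.add_lt_add_iff_left ENNReal.ofReal_ne_top] at htc
      exact htc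
  have hlt : ENNReal.ofReal r < ENNReal.ofReal r + freeExitTime G ε (freeFlight G r z) :=
    ENNReal.lt_add_right ENNReal.ofReal_ne_top hpos.ne'
  rw [hr, ENNReal.ofReal_toReal hτ] at hle hlt
  exact (lt_irrefl _) (hlt.trans_le hle)

end Regular

/-! ## Simple incoming collision configurations with a named pair -/

variable (G ε) in
/-- `z` is a simple incoming collision configuration *with colliding pair `p = (i, j)`, `i < j`*:
`(i, j)` is incoming and the pairs in contact in `z` are exactly `(i, j)` and `(j, i)`
(`IsSimpleIncoming G ε z ↔ ∃ p, IsSimpleIncomingWith G ε z p`; GST 2013 §4.1 p. 19: a binary,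
non-grazing collision). [cite: GST2013, §4.1 p. 19] -/
def IsSimpleIncomingWith (z : Config N d X) (p : Fin N × Fin N) : Prop :=
  p.1 < p.2 ∧ IsIncoming G z p.1 p.2 ∧
    ∀ i j : Fin N, i ≠ j → (z ∈ contactSet G N ε i j ↔ ({i, j} : Finset (Fin N)) = {p.1, p.2})

/-- `IsSimpleIncoming` is `IsSimpleIncomingWith` for some pair. [folklore] -/
theorem isSimpleIncoming_iff {z : Config N d X} :
    IsSimpleIncoming G ε z ↔ ∃ p, IsSimpleIncomingWith G ε z p :=
  Iff.rfl

/-- Two unordered pairs of `Fin N` written as two-element finsets coincide iff they coincide as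
ordered pairs up to swapping. [folklore] -/
theorem finsetPair_eq_iff {i j a b : Fin N} :
    ({i, j} : Finset (Fin N)) = {a, b} ↔ i = a ∧ j = b ∨ i = b ∧ j = a := by
  rw [← Finset.coe_inj, Finset.coe_pair, Finset.coe_pair, Set.pair_eq_pair_iff]

namespace IsSimpleIncomingWith

variable {z : Config N d X} {p : Fin N × Fin N}

/-- The colliding pair consists of two distinct particles. [folklore] -/
theorem ne (hp : IsSimpleIncomingWith G ε z p) : p.1 ≠ p.2 := ne_of_lt hp.1

/-- The colliding pair is incoming. [folklore] -/
theorem isIncoming (hp : IsSimpleIncomingWith G ε z p) : IsIncoming G z p.1 p.2 := hp.2.1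

/-- The colliding pair is in contact. [folklore] -/
theorem mem_contactSet (hp : IsSimpleIncomingWith G ε z p) : z ∈ contactSet G N ε p.1 p.2 :=
  (hp.2.2 p.1 p.2 hp.ne).2 rfl

/-- A simple incoming collision configuration lies in the hard-sphere domain. [folklore] -/
theorem mem_hardSphereDomain (hp : IsSimpleIncomingWith G ε z p) : z ∈ hardSphereDomain G N ε :=
  hp.mem_contactSet.1

/-- Any contact pair of a simple incoming collision configuration is the colliding pair up to
order. [folklore] -/
theorem eq_or_eq_of_mem_contactSet (hp : IsSimpleIncomingWith G ε z p) {i j : Fin N} (hij : i ≠ j)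
    (hc : z ∈ contactSet G N ε i j) : i = p.1 ∧ j = p.2 ∨ i = p.2 ∧ j = p.1 :=
  finsetPair_eq_iff.1 ((hp.2.2 i j hij).1 hc)

/-- The swapped colliding pair is in contact too, provided contact is symmetric (regular
geometry). [folklore] -/
theorem mem_contactSet_swap [TopologicalSpace X] (hG : G.IsHardSphereRegular ε)
    (hp : IsSimpleIncomingWith G ε z p) : z ∈ contactSet G N ε p.2 p.1 :=
  hG.mem_contactSet_comm.1 hp.mem_contactSet

/-- The ordered incoming contact pairs of a simple incoming collision configuration are exactly
the colliding pair. [folklore] -/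
theorem incomingPairs_eq (hp : IsSimpleIncomingWith G ε z p) : incomingPairs G ε z = {p} := by
  ext q
  simp only [mem_incomingPairs, mem_singleton_iff]
  constructor
  · rintro ⟨hq, hc, -⟩
    rcases hp.eq_or_eq_of_mem_contactSet (ne_of_lt hq) hc with ⟨h1, h2⟩ | ⟨h1, h2⟩
    · exact Prod.ext h1 h2
    · rw [h1, h2] at hq
      exact ((lt_asymm hq) hp.1).elim
  · rintro rfl
    exact ⟨hp.1, hp.mem_contactSet, hp.isIncoming⟩

/-- In a regular geometry every contact pair of a simple incoming collision configuration is
incoming (in either order). [folklore] -/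
theorem isIncoming_of_mem_contactSet [TopologicalSpace X] (hG : G.IsHardSphereRegular ε)
    (hp : IsSimpleIncomingWith G ε z p) {i j : Fin N} (hij : i ≠ j)
    (hc : z ∈ contactSet G N ε i j) : IsIncoming G z i j := by
  rcases hp.eq_or_eq_of_mem_contactSet hij hc with ⟨rfl, rfl⟩ | ⟨rfl, rfl⟩
  · exact hp.isIncoming
  · exact (hG.isIncoming_comm hp.mem_contactSet.2.le).2 hp.isIncoming

/-- In a regular geometry, after the elastic collision of the colliding pair every contact pair
is outgoing. [folklore] -/
theorem isOutgoing_collidePair [TopologicalSpace X] (hG : G.IsHardSphereRegular ε)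
    (hp : IsSimpleIncomingWith G ε z p) {i j : Fin N} (hij : i ≠ j)
    (hc : z ∈ contactSet G N ε i j) : IsOutgoing G (collidePair G p.1 p.2 z) i j := by
  have hout : IsOutgoing G (collidePair G p.1 p.2 z) p.1 p.2 :=
    (isOutgoing_collidePair_iff hp.ne z).2 hp.isIncoming
  rcases hp.eq_or_eq_of_mem_contactSet hij hc with ⟨rfl, rfl⟩ | ⟨rfl, rfl⟩
  · exact hout
  · have hle : ‖G.sepVec ((collidePair G p.1 p.2 z) p.1).1 ((collidePair G p.1 p.2 z) p.2).1‖ ≤ ε := by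
      rw [collidePair_apply_fst, collidePair_apply_fst]
      exact hp.mem_contactSet.2.le
    exact (hG.isOutgoing_comm hle).2 hout

/-- In a regular geometry the elastic collision of any contact pair of a simple incoming
collision configuration `c'` with the same positions as `z` is the collision of the colliding
pair (the reflection law is symmetric in the pair at contact). [folklore] -/
theorem collidePair_eq [TopologicalSpace X] (hG : G.IsHardSphereRegular ε)
    (hp : IsSimpleIncomingWith G ε z p) {c : Config N d X} (hcz : ∀ k, (c k).1 = (z k).1)
    {i j : Fin N} (hij : i ≠ j) (hc : z ∈ contactSet G N ε i j) :
    collidePair G i j c = collidePair G p.1 p.2 c := by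
  rcases hp.eq_or_eq_of_mem_contactSet hij hc with ⟨rfl, rfl⟩ | ⟨rfl, rfl⟩
  · rfl
  · refine hG.collidePair_comm hp.ne ?_
    rw [hcz, hcz]
    exact hp.mem_contactSet.2.le

/-- Transport of `IsSimpleIncomingWith` to a configuration with the same positions in which the
colliding pair is still incoming. [folklore] -/
theorem of_fst_eq (hp : IsSimpleIncomingWith G ε z p) {c : Config N d X}
    (hcz : ∀ k, (c k).1 = (z k).1) (hin : IsIncoming G c p.1 p.2) : IsSimpleIncomingWith G ε c p :=
  ⟨hp.1, hin, fun i j hij => by rw [mem_contactSet_congr_fst hcz]; exact hp.2.2 i j hij⟩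

/-- **After a simple collision the exit time is positive** (regular geometry): the
post-collisional configuration `collidePair G i j z` has only outgoing contact pairs. [folklore] -/
theorem freeExitTime_collidePair_pos [TopologicalSpace X] (hG : G.IsHardSphereRegular ε)
    (hp : IsSimpleIncomingWith G ε z p) : 0 < freeExitTime G ε (collidePair G p.1 p.2 z) := by
  refine freeExitTime_pos hG ((collidePair_mem_hardSphereDomain_iff z).2 hp.mem_hardSphereDomain)
    fun i j hij hc hin => ?_
  have hc' : z ∈ contactSet G N ε i j :=
    (mem_contactSet_congr_fst fun k => collidePair_apply_fst z k).1 hc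
  have hout := hp.isOutgoing_collidePair hG hij hc'
  exact lt_asymm hin hout

end IsSimpleIncomingWith

/-- **The collision step at a simple incoming exit configuration** is the elastic collision of
its colliding pair (no choice is involved: `incomingPairs = {p}`). [folklore] -/
theorem collisionStep_eq_collidePair {z : Config N d X} (hτ : freeExitTime G ε z ≠ ∞)
    {p : Fin N × Fin N}
    (hp : IsSimpleIncomingWith G ε (freeFlight G (freeExitTime G ε z).toReal z) p) :
    collisionStep G ε z = collidePair G p.1 p.2 (freeFlight G (freeExitTime G ε z).toReal z) := by
  have hne : (incomingPairs G ε (freeFlight G (freeExitTime G ε z).toReal z)).Nonempty :=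
    ⟨p, by rw [hp.incomingPairs_eq]; rfl⟩
  have hsome : hne.some = p := hp.incomingPairs_eq.subset hne.some_mem
  simp only [collisionStep, hτ, if_false]
  rw [dif_pos hne, hsome]


/-! ## Counting collisions: segments of the forward flow (no hypotheses on the datum) -/

section Count

variable {y : Config N d X}

/-- If `t_k ≤ u < t_{k+1}` then `k` collisions are counted in `[0, u]` (monotonicity of the
instants only; no non-accumulation hypothesis is needed in this direction). [folklore] -/
theorem collisionCount_eq_of_segment {u : ℝ} {k : ℕ}
    (h1 : collisionInstant G ε y k ≤ ENNReal.ofReal u)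
    (h2 : ENNReal.ofReal u < collisionInstant G ε y (k + 1)) : collisionCount G ε y u = k := by
  have hub : ∀ m ∈ {m : ℕ | collisionInstant G ε y m ≤ ENNReal.ofReal u}, m ≤ k := by
    intro m hm
    by_contra hmk
    exact (not_le.2 h2) ((monotone_collisionInstant y (Nat.succ_le_of_lt (not_le.1 hmk))).trans hm)
  exact le_antisymm (csSup_le' hub) (le_csSup ⟨k, hub⟩ h1)

/-- If `t_k < u ≤ t_{k+1}` (or `k = 0` and `u ≤ t_1`) then `k` collisions are counted in
`[0, u)`. [folklore] -/
theorem collisionCountBefore_eq_of_segment {u : ℝ} {k : ℕ}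
    (h1 : collisionInstant G ε y k < ENNReal.ofReal u ∨ k = 0)
    (h2 : ENNReal.ofReal u ≤ collisionInstant G ε y (k + 1)) :
    collisionCountBefore G ε y u = k := by
  have hub : ∀ m ∈ {m : ℕ | collisionInstant G ε y m < ENNReal.ofReal u}, m ≤ k := by
    intro m hm
    by_contra hmk
    exact (not_lt.2 h2)
      ((monotone_collisionInstant y (Nat.succ_le_of_lt (not_le.1 hmk))).trans_lt hm)
  refine le_antisymm (csSup_le' hub) ?_
  rcases h1 with h1 | rfl
  · exact le_csSup ⟨k, hub⟩ h1
  · exact Nat.zero_le _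

/-- On the segment `t_k ≤ u < t_{k+1}` the forward flow is `S_{u - t_k} z_k`. [folklore] -/
theorem fwdFlow_eq_of_segment {u : ℝ} {k : ℕ}
    (h1 : collisionInstant G ε y k ≤ ENNReal.ofReal u)
    (h2 : ENNReal.ofReal u < collisionInstant G ε y (k + 1)) :
    fwdFlow G ε y u =
      freeFlight G (u - (collisionInstant G ε y k).toReal) (stateAfter G ε y k) := by
  rw [fwdFlow, collisionCount_eq_of_segment h1 h2]

/-- On the segment `t_k < u ≤ t_{k+1}` (or `k = 0`, `u ≤ t_1`) the left-continuous forward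
flow is `S_{u - t_k} z_k`. [folklore] -/
theorem fwdFlowLeft_eq_of_segment {u : ℝ} {k : ℕ}
    (h1 : collisionInstant G ε y k < ENNReal.ofReal u ∨ k = 0)
    (h2 : ENNReal.ofReal u ≤ collisionInstant G ε y (k + 1)) :
    fwdFlowLeft G ε y u =
      freeFlight G (u - (collisionInstant G ε y k).toReal) (stateAfter G ε y k) := by
  rw [fwdFlowLeft, collisionCountBefore_eq_of_segment h1 h2]

/-- At nonpositive times the left-continuous forward flow is free flight (no instant is
`< u ≤ 0`). [folklore] -/
theorem fwdFlowLeft_of_nonpos {u : ℝ} (hu : u ≤ 0) : fwdFlowLeft G ε y u = freeFlight G u y :=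
  fwdFlowLeft_eq_freeFlight_of_le (by simp [ENNReal.ofReal_of_nonpos hu])

/-- Arithmetic of a segment: if `t_k ≤ u` (`u ≥ 0`) and `u < t_k + c` then `0 ≤ u - t_k` and
`u - t_k < c` (in `ℝ≥0∞`). [folklore] -/
theorem ofReal_sub_toReal_lt {a c : ℝ≥0∞} {u : ℝ} (hu : 0 ≤ u) (ha : a ≤ ENNReal.ofReal u)
    (h : ENNReal.ofReal u < a + c) : ENNReal.ofReal (u - a.toReal) < c := by
  have ha' : a ≠ ∞ := ne_top_of_le_ne_top ENNReal.ofReal_ne_top ha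
  have hle : a.toReal ≤ u := ENNReal.toReal_le_of_le_ofReal hu ha
  have hsplit : ENNReal.ofReal u = a + ENNReal.ofReal (u - a.toReal) := by
    rw [← ENNReal.ofReal_toReal ha', ENNReal.toReal_ofReal ENNReal.toReal_nonneg,
      ← ENNReal.ofReal_add ENNReal.toReal_nonneg (sub_nonneg.2 hle), add_sub_cancel]
  rw [hsplit, ENNReal.add_lt_add_iff_left ha'] at h
  exact h

end Count

/-! ## Forward-good data: states, instants and segments -/

namespace FwdGood

variable {y : Config N d X}

/-- On a forward-good orbit each finite free flight ends in a simple incoming collision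
configuration, and the next state is the elastic collision of its colliding pair. [folklore] -/
theorem exists_stateAfter_succ (hgood : FwdGood G ε y) {k : ℕ}
    (hk : freeExitTime G ε (stateAfter G ε y k) ≠ ∞) :
    ∃ p, IsSimpleIncomingWith G ε
        (freeFlight G (freeExitTime G ε (stateAfter G ε y k)).toReal (stateAfter G ε y k)) p ∧
      stateAfter G ε y (k + 1) = collidePair G p.1 p.2
        (freeFlight G (freeExitTime G ε (stateAfter G ε y k)).toReal (stateAfter G ε y k)) := by
  obtain ⟨p, hp⟩ := hgood.1 k hk
  exact ⟨p, hp, by rw [stateAfter_succ, collisionStep_eq_collidePair hk hp]⟩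

/-- All states of a forward-good orbit started in the domain lie in the domain. [folklore] -/
theorem stateAfter_mem (hy : y ∈ hardSphereDomain G N ε) (hgood : FwdGood G ε y) (k : ℕ) :
    stateAfter G ε y k ∈ hardSphereDomain G N ε := by
  induction k with
  | zero => exact hy
  | succ k ih =>
    by_cases hk : freeExitTime G ε (stateAfter G ε y k) = ∞
    · rw [stateAfter_succ, collisionStep_of_eq_top hk]
      exact ih
    · obtain ⟨p, hp, heq⟩ := hgood.exists_stateAfter_succ hk
      rw [heq]
      exact (collidePair_mem_hardSphereDomain_iff _).2 hp.mem_hardSphereDomain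

/-- The collision instants of a forward-good orbit do not accumulate: they exceed every finite
bound. [folklore] -/
theorem exists_lt_collisionInstant (hgood : FwdGood G ε y) {c : ℝ≥0∞} (hc : c ≠ ∞) :
    ∃ k, c < collisionInstant G ε y k := by
  have ht : Tendsto (collisionInstant G ε y) atTop (𝓝 ∞) := by
    have h := ENNReal.tendsto_nat_tsum fun m => freeExitTime G ε (stateAfter G ε y m)
    rwa [hgood.2.2] at h
  exact (ht.eventually (lt_mem_nhds hc.lt_top)).exists

/-- Every time `u` lies in a segment `[t_k, t_{k+1})` of a forward-good orbit. [folklore] -/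
theorem exists_segment (hgood : FwdGood G ε y) (u : ℝ) :
    ∃ k, collisionInstant G ε y k ≤ ENNReal.ofReal u ∧
      ENNReal.ofReal u < collisionInstant G ε y (k + 1) := by
  classical
  have hex : ∃ k, ENNReal.ofReal u < collisionInstant G ε y k :=
    hgood.exists_lt_collisionInstant ENNReal.ofReal_ne_top
  have hK := Nat.find_spec hex
  have hK0 : Nat.find hex ≠ 0 := by
    intro h0
    rw [h0, collisionInstant_zero] at hK
    exact ENNReal.not_lt_zero hK
  obtain ⟨k, hk⟩ := Nat.exists_eq_succ_of_ne_zero hK0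
  rw [hk] at hK
  exact ⟨k, not_lt.1 (Nat.find_min hex (by omega)), hK⟩

/-- Every positive time `u` lies in a segment `(t_k, t_{k+1}]` of a forward-good orbit. [folklore] -/
theorem exists_segment_left (hgood : FwdGood G ε y) {u : ℝ} (hu : 0 < u) :
    ∃ k, collisionInstant G ε y k < ENNReal.ofReal u ∧
      ENNReal.ofReal u ≤ collisionInstant G ε y (k + 1) := by
  classical
  have hex : ∃ k, ENNReal.ofReal u ≤ collisionInstant G ε y k := by
    obtain ⟨k, hk⟩ := hgood.exists_lt_collisionInstant (c := ENNReal.ofReal u) ENNReal.ofReal_ne_top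
    exact ⟨k, hk.le⟩
  have hK := Nat.find_spec hex
  have hK0 : Nat.find hex ≠ 0 := by
    intro h0
    rw [h0, collisionInstant_zero, nonpos_iff_eq_zero, ENNReal.ofReal_eq_zero] at hK
    exact (not_le.2 hu) hK
  obtain ⟨k, hk⟩ := Nat.exists_eq_succ_of_ne_zero hK0
  rw [hk] at hK
  exact ⟨k, not_le.1 (Nat.find_min hex (by omega)), hK⟩

section Regular

variable [TopologicalSpace X]

/-- On a forward-good orbit of a regular geometry every post-collisional state has a positive
exit time: collisions do not happen at the same instant. [folklore] -/
theorem freeExitTime_stateAfter_succ_pos (hG : G.IsHardSphereRegular ε) (hgood : FwdGood G ε y)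
    (k : ℕ) : 0 < freeExitTime G ε (stateAfter G ε y (k + 1)) := by
  by_cases hk : freeExitTime G ε (stateAfter G ε y k) = ∞
  · rw [stateAfter_succ, collisionStep_of_eq_top hk, hk]
    exact ENNReal.zero_lt_top
  · obtain ⟨p, hp, heq⟩ := hgood.exists_stateAfter_succ hk
    rw [heq]
    exact hp.freeExitTime_collidePair_pos hG

/-- The finite collision instants of positive index are strictly increasing. [folklore] -/
theorem collisionInstant_lt_succ (hG : G.IsHardSphereRegular ε) (hgood : FwdGood G ε y) {k : ℕ}
    (hk : 0 < k) (hfin : collisionInstant G ε y k ≠ ∞) :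
    collisionInstant G ε y k < collisionInstant G ε y (k + 1) := by
  rw [collisionInstant_succ]
  obtain ⟨m, rfl⟩ := Nat.exists_eq_succ_of_ne_zero hk.ne'
  exact ENNReal.lt_add_right hfin (hgood.freeExitTime_stateAfter_succ_pos hG m).ne'

/-- `t_k < t_{k+1}` as soon as `t_k` is finite and either `k > 0` or `τ(y) > 0`. [folklore] -/
theorem collisionInstant_lt_succ' (hG : G.IsHardSphereRegular ε) (hgood : FwdGood G ε y) {k : ℕ}
    (hk : 0 < k ∨ 0 < freeExitTime G ε y) (hfin : collisionInstant G ε y k ≠ ∞) :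
    collisionInstant G ε y k < collisionInstant G ε y (k + 1) := by
  rcases Nat.eq_zero_or_pos k with rfl | hpos
  · have h0 : 0 < freeExitTime G ε y := hk.resolve_left (lt_irrefl 0)
    simpa using h0
  · exact hgood.collisionInstant_lt_succ hG hpos hfin

/-- The forward flow at a finite collision instant `t_k` is the post-collisional state `z_k`
(right-continuity convention), provided `k > 0` or `τ(y) > 0`. [folklore] -/
theorem fwdFlow_collisionInstant (hG : G.IsHardSphereRegular ε) (hgood : FwdGood G ε y) {k : ℕ}
    (hfin : collisionInstant G ε y k ≠ ∞) (hk : 0 < k ∨ 0 < freeExitTime G ε y) :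
    fwdFlow G ε y (collisionInstant G ε y k).toReal = stateAfter G ε y k := by
  rw [fwdFlow_eq_of_segment (k := k) (by rw [ENNReal.ofReal_toReal hfin])
    (by rw [ENNReal.ofReal_toReal hfin]; exact hgood.collisionInstant_lt_succ' hG hk hfin),
    sub_self, freeFlight_zero]

/-- The left-continuous forward flow at a finite collision instant `t_{k+1}` is the
pre-collisional configuration `S_{τ(z_k)} z_k`. [folklore] -/
theorem fwdFlowLeft_collisionInstant_succ (hG : G.IsHardSphereRegular ε) (hgood : FwdGood G ε y)
    {k : ℕ} (hfin : collisionInstant G ε y (k + 1) ≠ ∞) :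
    fwdFlowLeft G ε y (collisionInstant G ε y (k + 1)).toReal =
      freeFlight G (freeExitTime G ε (stateAfter G ε y k)).toReal (stateAfter G ε y k) := by
  have hfin' : collisionInstant G ε y k ≠ ∞ ∧ freeExitTime G ε (stateAfter G ε y k) ≠ ∞ := by
    rwa [collisionInstant_succ, ENNReal.add_ne_top] at hfin
  rw [fwdFlowLeft_eq_of_segment (k := k) ?_ (by rw [ENNReal.ofReal_toReal hfin])]
  · rw [collisionInstant_succ, ENNReal.toReal_add hfin'.1 hfin'.2, add_sub_cancel_left]
  · rcases Nat.eq_zero_or_pos k with rfl | hk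
    · exact Or.inr rfl
    · left
      rw [ENNReal.ofReal_toReal hfin]
      exact hgood.collisionInstant_lt_succ hG hk hfin'.1

end Regular

end FwdGood

/-! ## The collision instants as a set of real times -/

variable (G ε) in
/-- The collision instants of the forward dynamics from `y` as a set of real times: the finite
`t_k` with `k ≥ 1` (for a datum with an incoming contact pair `t_1 = 0` belongs to it). [folklore] -/
def instantSet (y : Config N d X) : Set ℝ :=
  {u | 0 ≤ u ∧ ∃ k, 0 < k ∧ collisionInstant G ε y k = ENNReal.ofReal u}

/-- Membership in `instantSet`. [folklore] -/
theorem mem_instantSet {y : Config N d X} {u : ℝ} :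
    u ∈ instantSet G ε y ↔ 0 ≤ u ∧ ∃ k, 0 < k ∧ collisionInstant G ε y k = ENNReal.ofReal u :=
  Iff.rfl

/-- A finite instant of positive index belongs to `instantSet`. [folklore] -/
theorem toReal_collisionInstant_mem_instantSet {y : Config N d X} {k : ℕ} (hk : 0 < k)
    (hfin : collisionInstant G ε y k ≠ ∞) :
    (collisionInstant G ε y k).toReal ∈ instantSet G ε y :=
  ⟨ENNReal.toReal_nonneg, k, hk, (ENNReal.ofReal_toReal hfin).symm⟩

namespace FwdGood

variable {y : Config N d X}

/-- The forward flow of a forward-good datum stays in the hard-sphere domain. [folklore] -/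
theorem fwdFlow_mem (hgood : FwdGood G ε y) {u : ℝ} (hu : 0 ≤ u) :
    fwdFlow G ε y u ∈ hardSphereDomain G N ε := by
  obtain ⟨k, h1, h2⟩ := hgood.exists_segment u
  rw [fwdFlow_eq_of_segment h1 h2]
  refine freeFlight_mem_hardSphereDomain_of_lt
    (sub_nonneg.2 (ENNReal.toReal_le_of_le_ofReal hu h1)) ?_
  rw [collisionInstant_succ] at h2
  exact ofReal_sub_toReal_lt hu h1 h2

/-- **Contacts happen only at instants** (right-continuous flow): a contact at a positive time
`u` forces `u ∈ instantSet` (no grazing touch inside a free-flight segment). [folklore] -/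
theorem mem_instantSet_of_fwdFlow_mem_contactSet (hgood : FwdGood G ε y) {u : ℝ} (hu : 0 < u)
    {i j : Fin N} (hij : i ≠ j) (hc : fwdFlow G ε y u ∈ contactSet G N ε i j) :
    u ∈ instantSet G ε y := by
  obtain ⟨k, h1, h2⟩ := hgood.exists_segment u
  rcases h1.lt_or_eq with hlt | heq
  · exfalso
    rw [fwdFlow_eq_of_segment h1 h2] at hc
    refine hgood.2.1 k _ (sub_pos.2 (ENNReal.toReal_lt_of_lt_ofReal hlt)) ?_ i j hij hc
    rw [collisionInstant_succ] at h2
    exact ofReal_sub_toReal_lt hu.le h1 h2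
  · refine ⟨hu.le, k, Nat.pos_of_ne_zero ?_, heq⟩
    rintro rfl
    rw [collisionInstant_zero] at heq
    exact (ENNReal.ofReal_pos.2 hu).ne heq

/-- **Free flight between instants** (right-continuous flow): if `(a, b]` contains no instant
then `Φ_b = S_{b-a} Φ_a`. [folklore] -/
theorem fwdFlow_eq_freeFlight_fwdFlow (hgood : FwdGood G ε y) {a b : ℝ} (ha : 0 ≤ a)
    (hab : a ≤ b) (hfree : ∀ u ∈ instantSet G ε y, u ∉ Ioc a b) :
    fwdFlow G ε y b = freeFlight G (b - a) (fwdFlow G ε y a) := by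
  obtain ⟨k, h1, h2⟩ := hgood.exists_segment a
  have h2b : ENNReal.ofReal b < collisionInstant G ε y (k + 1) := by
    by_contra hle
    rw [not_lt] at hle
    have hfin : collisionInstant G ε y (k + 1) ≠ ∞ := ne_top_of_le_ne_top ENNReal.ofReal_ne_top hle
    refine hfree _ (toReal_collisionInstant_mem_instantSet (Nat.succ_pos k) hfin) ⟨?_, ?_⟩
    · exact (ENNReal.ofReal_lt_iff_lt_toReal ha hfin).1 h2
    · exact ENNReal.toReal_le_of_le_ofReal (ha.trans hab) hle
  rw [fwdFlow_eq_of_segment h1 h2,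
    fwdFlow_eq_of_segment (h1.trans (ENNReal.ofReal_le_ofReal hab)) h2b, ← freeFlight_add]
  congr 1
  ring

/-- **Free flight between instants** (left-continuous flow): if `[a, b)` contains no instant
then `Φ_{b⁻} = S_{b-a} Φ_{a⁻}`. [folklore] -/
theorem fwdFlowLeft_eq_freeFlight_fwdFlowLeft (hgood : FwdGood G ε y) {a b : ℝ} (ha : 0 ≤ a)
    (hab : a ≤ b) (hfree : ∀ u ∈ instantSet G ε y, u ∉ Ico a b) :
    fwdFlowLeft G ε y b = freeFlight G (b - a) (fwdFlowLeft G ε y a) := by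
  rcases hab.eq_or_lt with rfl | hab'
  · simp
  have hb : 0 < b := ha.trans_lt hab'
  obtain ⟨k, h1, h2⟩ := hgood.exists_segment_left hb
  have hka : collisionInstant G ε y k < ENNReal.ofReal a ∨ k = 0 := by
    rcases Nat.eq_zero_or_pos k with rfl | hk
    · exact Or.inr rfl
    · left
      by_contra hle
      rw [not_lt] at hle
      have hfin : collisionInstant G ε y k ≠ ∞ := ne_top_of_lt h1
      refine hfree _ (toReal_collisionInstant_mem_instantSet hk hfin) ⟨?_, ?_⟩
      · exact (ENNReal.ofReal_le_iff_le_toReal hfin).1 hle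
      · exact ENNReal.toReal_lt_of_lt_ofReal h1
  rw [fwdFlowLeft_eq_of_segment (Or.inl h1) h2,
    fwdFlowLeft_eq_of_segment hka ((ENNReal.ofReal_le_ofReal hab).trans h2), ← freeFlight_add]
  congr 1
  ring

/-- The instants of a forward-good orbit are locally finite. [folklore] -/
theorem finite_instantSet_inter_Iic (hgood : FwdGood G ε y) (b : ℝ) :
    (instantSet G ε y ∩ Iic b).Finite := by
  obtain ⟨K, hK⟩ := hgood.exists_lt_collisionInstant (c := ENNReal.ofReal b) ENNReal.ofReal_ne_top
  refine ((Finset.range K).finite_toSet.image fun k => (collisionInstant G ε y k).toReal).subset ?_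
  rintro u ⟨⟨hu0, k, -, hTk⟩, hub⟩
  refine ⟨k, ?_, ?_⟩
  · rw [Finset.coe_range, mem_Iio]
    by_contra hkK
    have hmono := monotone_collisionInstant (G := G) (ε := ε) y (not_lt.1 hkK)
    rw [hTk] at hmono
    exact (lt_irrefl _) ((hK.trans_le hmono).trans_le (ENNReal.ofReal_le_ofReal hub))
  · change (collisionInstant G ε y k).toReal = u
    rw [hTk, ENNReal.toReal_ofReal hu0]

variable [TopologicalSpace X]

/-- **The jump at a collision instant**: at `u ∈ instantSet`, the left-continuous forward flow
is a simple incoming collision configuration and the forward flow is the elastic collision of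
its colliding pair. [folklore] -/
theorem exists_jump (hG : G.IsHardSphereRegular ε) (hgood : FwdGood G ε y) {u : ℝ}
    (hu : u ∈ instantSet G ε y) :
    ∃ p, IsSimpleIncomingWith G ε (fwdFlowLeft G ε y u) p ∧
      fwdFlow G ε y u = collidePair G p.1 p.2 (fwdFlowLeft G ε y u) := by
  obtain ⟨hu0, k, hk, hTk⟩ := hu
  obtain ⟨m, rfl⟩ := Nat.exists_eq_succ_of_ne_zero hk.ne'
  have hfin : collisionInstant G ε y (m + 1) ≠ ∞ := by rw [hTk]; exact ENNReal.ofReal_ne_top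
  have hu' : u = (collisionInstant G ε y (m + 1)).toReal := by
    rw [hTk, ENNReal.toReal_ofReal hu0]
  have hτ : freeExitTime G ε (stateAfter G ε y m) ≠ ∞ := by
    have h := hfin
    rw [collisionInstant_succ, ENNReal.add_ne_top] at h
    exact h.2
  obtain ⟨p, hp, heq⟩ := hgood.exists_stateAfter_succ hτ
  refine ⟨p, ?_, ?_⟩
  · rw [hu', hgood.fwdFlowLeft_collisionInstant_succ hG hfin]
    exact hp
  · rw [hu', hgood.fwdFlowLeft_collisionInstant_succ hG hfin,
      hgood.fwdFlow_collisionInstant hG hfin (Or.inl (Nat.succ_pos m)), heq]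

/-- The left-continuous and the right-continuous forward flows have the same positions
(collisions do not move particles). [folklore] -/
theorem fwdFlowLeft_apply_fst (hG : G.IsHardSphereRegular ε) (hgood : FwdGood G ε y) {u : ℝ}
    (hu : 0 ≤ u) (i : Fin N) : (fwdFlowLeft G ε y u i).1 = (fwdFlow G ε y u i).1 := by
  obtain ⟨k, h1, h2⟩ := hgood.exists_segment u
  by_cases h : collisionInstant G ε y k < ENNReal.ofReal u ∨ k = 0
  · rw [fwdFlowLeft_eq_of_segment h h2.le, fwdFlow_eq_of_segment h1 h2]
  · have hk : 0 < k := Nat.pos_of_ne_zero fun h0 => h (Or.inr h0)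
    have heq : collisionInstant G ε y k = ENNReal.ofReal u :=
      le_antisymm h1 (not_lt.1 fun hlt => h (Or.inl hlt))
    obtain ⟨p, -, hjump⟩ := hgood.exists_jump hG ⟨hu, k, hk, heq⟩
    rw [hjump, collidePair_apply_fst]

/-- The left-continuous forward flow of a forward-good datum stays in the domain. [folklore] -/
theorem fwdFlowLeft_mem (hG : G.IsHardSphereRegular ε) (hgood : FwdGood G ε y) {u : ℝ}
    (hu : 0 ≤ u) : fwdFlowLeft G ε y u ∈ hardSphereDomain G N ε :=
  (mem_hardSphereDomain_congr_fst (hgood.fwdFlowLeft_apply_fst hG hu)).2 (hgood.fwdFlow_mem hu)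

/-- **Contacts happen only at instants** (left-continuous flow): a contact at a time `u ≥ 0`,
incoming if `u = 0`, forces `u ∈ instantSet`. [folklore] -/
theorem mem_instantSet_of_fwdFlowLeft_mem_contactSet (hG : G.IsHardSphereRegular ε)
    (hgood : FwdGood G ε y) {u : ℝ} (hu : 0 ≤ u) {i j : Fin N} (hij : i ≠ j)
    (hc : fwdFlowLeft G ε y u ∈ contactSet G N ε i j)
    (h0 : u = 0 → IsIncoming G (fwdFlowLeft G ε y u) i j) : u ∈ instantSet G ε y := by
  rcases hu.eq_or_lt with rfl | hu'
  · have hL : fwdFlowLeft G ε y 0 = y := by rw [fwdFlowLeft_of_nonpos le_rfl, freeFlight_zero]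
    rw [hL] at hc h0
    refine ⟨le_rfl, 1, one_pos, ?_⟩
    rw [collisionInstant_one, ENNReal.ofReal_zero,
      freeExitTime_eq_zero_of_isIncoming hG hij hc (h0 rfl)]
  · obtain ⟨k, h1, h2⟩ := hgood.exists_segment_left hu'
    rcases h2.lt_or_eq with hlt | heq
    · exfalso
      rw [fwdFlowLeft_eq_of_segment (Or.inl h1) h2] at hc
      refine hgood.2.1 k _ (sub_pos.2 (ENNReal.toReal_lt_of_lt_ofReal h1)) ?_ i j hij hc
      rw [collisionInstant_succ] at hlt
      exact ofReal_sub_toReal_lt hu h1.le hlt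
    · exact ⟨hu, k + 1, Nat.succ_pos k, heq.symm⟩

/-- At an instant the forward flow is in contact (for the colliding pair). [folklore] -/
theorem exists_fwdFlow_mem_contactSet (hG : G.IsHardSphereRegular ε) (hgood : FwdGood G ε y)
    {u : ℝ} (hu : u ∈ instantSet G ε y) :
    ∃ p : Fin N × Fin N, p.1 ≠ p.2 ∧ fwdFlow G ε y u ∈ contactSet G N ε p.1 p.2 := by
  obtain ⟨p, hp, hjump⟩ := hgood.exists_jump hG hu
  refine ⟨p, hp.ne, ?_⟩
  rw [hjump]
  exact (mem_contactSet_congr_fst fun k => collidePair_apply_fst _ k).2 hp.mem_contactSet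

/-! ## One-sided limits of the forward flow -/

/-- The forward flow is right-continuous. [folklore] -/
theorem tendsto_fwdFlow_nhdsGT (hG : G.IsHardSphereRegular ε) (hgood : FwdGood G ε y) (u : ℝ) :
    Tendsto (fwdFlow G ε y) (𝓝[>] u) (𝓝 (fwdFlow G ε y u)) := by
  obtain ⟨k, h1, h2⟩ := hgood.exists_segment u
  have hev : ∀ᶠ w in 𝓝[>] u, fwdFlow G ε y w =
      freeFlight G (w - (collisionInstant G ε y k).toReal) (stateAfter G ε y k) := by
    have hopen : ∀ᶠ w in 𝓝 u, ENNReal.ofReal w < collisionInstant G ε y (k + 1) :=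
      (isOpen_Iio.preimage ENNReal.continuous_ofReal).mem_nhds h2
    filter_upwards [mem_nhdsWithin_of_mem_nhds hopen, self_mem_nhdsWithin] with w hw1 hw2
    exact fwdFlow_eq_of_segment (h1.trans (ENNReal.ofReal_le_ofReal (le_of_lt hw2))) hw1
  have hc : Continuous fun w : ℝ =>
      freeFlight G (w - (collisionInstant G ε y k).toReal) (stateAfter G ε y k) := by
    have h := hG.continuous_freeFlight (N := N) (stateAfter G ε y k)
    fun_prop
  rw [fwdFlow_eq_of_segment h1 h2]
  exact ((hc.tendsto u).mono_left nhdsWithin_le_nhds).congr' (hev.mono fun w hw => hw.symm)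

/-- The forward flow has left limits, given by the left-continuous forward flow. [folklore] -/
theorem tendsto_fwdFlow_nhdsLT (hG : G.IsHardSphereRegular ε) (hgood : FwdGood G ε y) {u : ℝ}
    (hu : 0 < u) : Tendsto (fwdFlow G ε y) (𝓝[<] u) (𝓝 (fwdFlowLeft G ε y u)) := by
  obtain ⟨k, h1, h2⟩ := hgood.exists_segment_left hu
  have hev : ∀ᶠ w in 𝓝[<] u, fwdFlow G ε y w =
      freeFlight G (w - (collisionInstant G ε y k).toReal) (stateAfter G ε y k) := by
    have hopen : ∀ᶠ w in 𝓝 u, collisionInstant G ε y k < ENNReal.ofReal w :=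
      (isOpen_Ioi.preimage ENNReal.continuous_ofReal).mem_nhds h1
    filter_upwards [mem_nhdsWithin_of_mem_nhds hopen, self_mem_nhdsWithin] with w hw1 hw2
    exact fwdFlow_eq_of_segment hw1.le (((ENNReal.ofReal_lt_ofReal_iff hu).2 hw2).trans_le h2)
  have hc : Continuous fun w : ℝ =>
      freeFlight G (w - (collisionInstant G ε y k).toReal) (stateAfter G ε y k) := by
    have h := hG.continuous_freeFlight (N := N) (stateAfter G ε y k)
    fun_prop
  rw [fwdFlowLeft_eq_of_segment (Or.inl h1) h2]
  exact ((hc.tendsto u).mono_left nhdsWithin_le_nhds).congr' (hev.mono fun w hw => hw.symm)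

/-- The left-continuous forward flow is left-continuous. [folklore] -/
theorem tendsto_fwdFlowLeft_nhdsLT (hG : G.IsHardSphereRegular ε) (hgood : FwdGood G ε y)
    {u : ℝ} (hu : 0 < u) : Tendsto (fwdFlowLeft G ε y) (𝓝[<] u) (𝓝 (fwdFlowLeft G ε y u)) := by
  obtain ⟨k, h1, h2⟩ := hgood.exists_segment_left hu
  have hev : ∀ᶠ w in 𝓝[<] u, fwdFlowLeft G ε y w =
      freeFlight G (w - (collisionInstant G ε y k).toReal) (stateAfter G ε y k) := by
    have hopen : ∀ᶠ w in 𝓝 u, collisionInstant G ε y k < ENNReal.ofReal w :=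
      (isOpen_Ioi.preimage ENNReal.continuous_ofReal).mem_nhds h1
    filter_upwards [mem_nhdsWithin_of_mem_nhds hopen, self_mem_nhdsWithin] with w hw1 hw2
    exact fwdFlowLeft_eq_of_segment (Or.inl hw1)
      (((ENNReal.ofReal_lt_ofReal_iff hu).2 hw2).le.trans h2)
  have hc : Continuous fun w : ℝ =>
      freeFlight G (w - (collisionInstant G ε y k).toReal) (stateAfter G ε y k) := by
    have h := hG.continuous_freeFlight (N := N) (stateAfter G ε y k)
    fun_prop
  rw [fwdFlowLeft_eq_of_segment (Or.inl h1) h2]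
  exact ((hc.tendsto u).mono_left nhdsWithin_le_nhds).congr' (hev.mono fun w hw => hw.symm)

/-- The left-continuous forward flow has right limits, given by the forward flow. [folklore] -/
theorem tendsto_fwdFlowLeft_nhdsGT (hG : G.IsHardSphereRegular ε) (hgood : FwdGood G ε y)
    {u : ℝ} (hu : 0 ≤ u) : Tendsto (fwdFlowLeft G ε y) (𝓝[>] u) (𝓝 (fwdFlow G ε y u)) := by
  obtain ⟨k, h1, h2⟩ := hgood.exists_segment u
  have hev : ∀ᶠ w in 𝓝[>] u, fwdFlowLeft G ε y w =
      freeFlight G (w - (collisionInstant G ε y k).toReal) (stateAfter G ε y k) := by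
    have hopen : ∀ᶠ w in 𝓝 u, ENNReal.ofReal w < collisionInstant G ε y (k + 1) :=
      (isOpen_Iio.preimage ENNReal.continuous_ofReal).mem_nhds h2
    filter_upwards [mem_nhdsWithin_of_mem_nhds hopen, self_mem_nhdsWithin] with w hw1 hw2
    have hw2' : ENNReal.ofReal u < ENNReal.ofReal w :=
      (ENNReal.ofReal_lt_ofReal_iff (hu.trans_lt hw2)).2 hw2
    exact fwdFlowLeft_eq_of_segment (Or.inl (h1.trans_lt hw2')) hw1.le
  have hc : Continuous fun w : ℝ =>
      freeFlight G (w - (collisionInstant G ε y k).toReal) (stateAfter G ε y k) := by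
    have h := hG.continuous_freeFlight (N := N) (stateAfter G ε y k)
    fun_prop
  rw [fwdFlow_eq_of_segment h1 h2]
  exact ((hc.tendsto u).mono_left nhdsWithin_le_nhds).congr' (hev.mono fun w hw => hw.symm)

end FwdGood

/-! ## Orbits of good points are hard-sphere trajectories -/

section Good

variable [TopologicalSpace X] {z : Config N d X}

/-- A good datum has a positive exit time (its contact pairs are outgoing). [folklore] -/
theorem freeExitTime_pos_of_mem_good (hG : G.IsHardSphereRegular ε) (hz : z ∈ good G ε) :
    0 < freeExitTime G ε z :=
  freeExitTime_pos hG hz.1 fun i j hij hc hin => lt_asymm hin (hz.2.1 i j hij hc).1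

/-- `T⁰ z = z` on the good set. [folklore] -/
theorem flow_zero_of_mem_good (hG : G.IsHardSphereRegular ε) (hz : z ∈ good G ε) :
    flow G ε 0 z = z :=
  flow_zero_of_pos (freeExitTime_pos_of_mem_good hG hz)

/-- For `t ≤ 0` (including `t = 0`) the flow of a good datum is the flipped left-continuous
forward flow of the flipped datum. [folklore] -/
theorem flow_of_nonpos (hG : G.IsHardSphereRegular ε) (hz : z ∈ good G ε) {t : ℝ} (ht : t ≤ 0) :
    flow G ε t z = flipVel (fwdFlowLeft G ε (flipVel z) (-t)) := by
  rcases ht.lt_or_eq with ht' | rfl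
  · exact flow_of_neg ht' z
  · rw [flow_zero_of_mem_good hG hz, neg_zero, fwdFlowLeft_of_nonpos le_rfl, freeFlight_zero,
      flipVel_flipVel]

/-- The positive collision times of the orbit of a good datum are the forward instants. [folklore] -/
theorem mem_collisionTimes_flow_iff_of_pos (hG : G.IsHardSphereRegular ε) (hz : z ∈ good G ε)
    {t : ℝ} (ht : 0 < t) :
    t ∈ collisionTimes G ε (fun s => flow G ε s z) ↔ t ∈ instantSet G ε z := by
  rw [mem_collisionTimes]
  simp only [flow_of_nonneg ht.le]
  constructor
  · rintro ⟨i, j, hij, hc⟩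
    exact hz.2.2.1.mem_instantSet_of_fwdFlow_mem_contactSet ht hij hc
  · intro h
    obtain ⟨p, hp, hc⟩ := hz.2.2.1.exists_fwdFlow_mem_contactSet hG h
    exact ⟨p.1, p.2, hp, hc⟩

/-- The nonpositive collision times of the orbit of a good datum are the negatives of the
forward instants of the flipped datum. [folklore] -/
theorem mem_collisionTimes_flow_iff_of_nonpos (hG : G.IsHardSphereRegular ε) (hz : z ∈ good G ε)
    {t : ℝ} (ht : t ≤ 0) :
    t ∈ collisionTimes G ε (fun s => flow G ε s z) ↔ -t ∈ instantSet G ε (flipVel z) := by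
  rw [mem_collisionTimes]
  simp only [flow_of_nonpos hG hz ht, flipVel_mem_contactSet_iff]
  constructor
  · rintro ⟨i, j, hij, hc⟩
    refine hz.2.2.2.mem_instantSet_of_fwdFlowLeft_mem_contactSet hG (neg_nonneg.2 ht) hij hc
      fun h0 => ?_
    have ht0 : t = 0 := by linarith
    subst ht0
    rw [neg_zero, fwdFlowLeft_of_nonpos le_rfl, freeFlight_zero] at hc ⊢
    rw [flipVel_mem_contactSet_iff] at hc
    exact (isIncoming_flipVel_iff z i j).2 (hz.2.1 i j hij hc).1
  · intro h
    obtain ⟨p, hp, -⟩ := hz.2.2.2.exists_jump hG h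
    exact ⟨p.1, p.2, hp.ne, hp.mem_contactSet⟩

/-- The collision times of the orbit of a good datum are locally finite. [folklore] -/
theorem finite_collisionTimes_flow_inter_Icc (hG : G.IsHardSphereRegular ε) (hz : z ∈ good G ε)
    (a b : ℝ) : (collisionTimes G ε (fun s => flow G ε s z) ∩ Icc a b).Finite := by
  refine ((hz.2.2.1.finite_instantSet_inter_Iic b).union
    ((hz.2.2.2.finite_instantSet_inter_Iic (-a)).image fun u => -u)).subset ?_
  rintro t ⟨ht, hta, htb⟩
  rcases lt_or_ge 0 t with h0 | h0
  · exact Or.inl ⟨(mem_collisionTimes_flow_iff_of_pos hG hz h0).1 ht, htb⟩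
  · refine Or.inr ⟨-t, ⟨(mem_collisionTimes_flow_iff_of_nonpos hG hz h0).1 ht, ?_⟩, neg_neg t⟩
    exact neg_le_neg hta

/-- The orbit of a good datum is right-continuous at nonnegative times. [folklore] -/
theorem tendsto_flow_nhdsGT_of_nonneg (hG : G.IsHardSphereRegular ε) (hz : z ∈ good G ε)
    {t : ℝ} (ht : 0 ≤ t) : Tendsto (fun s => flow G ε s z) (𝓝[>] t) (𝓝 (flow G ε t z)) := by
  have hev : ∀ᶠ s in 𝓝[>] t, fwdFlow G ε z s = flow G ε s z := by
    filter_upwards [self_mem_nhdsWithin] with s hs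
    exact (flow_of_nonneg (ht.trans (le_of_lt hs)) z).symm
  rw [flow_of_nonneg ht]
  exact (hz.2.2.1.tendsto_fwdFlow_nhdsGT hG t).congr' hev

/-- The orbit of a good datum has left limit `Φ_{t⁻}` at positive times. [folklore] -/
theorem tendsto_flow_nhdsLT_of_pos (hG : G.IsHardSphereRegular ε) (hz : z ∈ good G ε)
    {t : ℝ} (ht : 0 < t) :
    Tendsto (fun s => flow G ε s z) (𝓝[<] t) (𝓝 (fwdFlowLeft G ε z t)) := by
  have hev : ∀ᶠ s in 𝓝[<] t, fwdFlow G ε z s = flow G ε s z := by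
    filter_upwards [mem_nhdsWithin_of_mem_nhds (Ioi_mem_nhds ht)] with s hs
    exact (flow_of_nonneg (le_of_lt hs) z).symm
  exact (hz.2.2.1.tendsto_fwdFlow_nhdsLT hG ht).congr' hev

/-- The orbit of a good datum has left limits at nonpositive times, given by the flipped
forward flow of the flipped datum. [folklore] -/
theorem tendsto_flow_nhdsLT_of_nonpos (hG : G.IsHardSphereRegular ε) (hz : z ∈ good G ε)
    {t : ℝ} (ht : t ≤ 0) :
    Tendsto (fun s => flow G ε s z) (𝓝[<] t) (𝓝 (flipVel (fwdFlow G ε (flipVel z) (-t)))) := by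
  have hev : ∀ᶠ s in 𝓝[<] t, flipVel (fwdFlowLeft G ε (flipVel z) (-s)) = flow G ε s z := by
    filter_upwards [self_mem_nhdsWithin] with s hs
    exact (flow_of_neg (lt_of_lt_of_le hs ht) z).symm
  have h1 : Tendsto (fun s : ℝ => -s) (𝓝[<] t) (𝓝[>] (-t)) := tendsto_neg_nhdsLT
  have h2 := (hz.2.2.2.tendsto_fwdFlowLeft_nhdsGT hG (neg_nonneg.2 ht)).comp h1
  have h3 : Tendsto (fun s : ℝ => flipVel (fwdFlowLeft G ε (flipVel z) (-s))) (𝓝[<] t)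
      (𝓝 (flipVel (fwdFlow G ε (flipVel z) (-t)))) :=
    (continuous_flipVel.tendsto _).comp h2
  exact h3.congr' hev

/-- The orbit of a good datum is right-continuous at negative times. [folklore] -/
theorem tendsto_flow_nhdsGT_of_neg (hG : G.IsHardSphereRegular ε) (hz : z ∈ good G ε)
    {t : ℝ} (ht : t < 0) : Tendsto (fun s => flow G ε s z) (𝓝[>] t) (𝓝 (flow G ε t z)) := by
  have hev : ∀ᶠ s in 𝓝[>] t, flipVel (fwdFlowLeft G ε (flipVel z) (-s)) = flow G ε s z := by
    filter_upwards [mem_nhdsWithin_of_mem_nhds (Iio_mem_nhds ht)] with s hs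
    exact (flow_of_neg hs z).symm
  have h1 : Tendsto (fun s : ℝ => -s) (𝓝[>] t) (𝓝[<] (-t)) := tendsto_neg_nhdsGT
  have h2 := (hz.2.2.2.tendsto_fwdFlowLeft_nhdsLT hG (neg_pos.2 ht)).comp h1
  have h3 : Tendsto (fun s : ℝ => flipVel (fwdFlowLeft G ε (flipVel z) (-s))) (𝓝[>] t)
      (𝓝 (flipVel (fwdFlowLeft G ε (flipVel z) (-t)))) :=
    (continuous_flipVel.tendsto _).comp h2
  rw [flow_of_neg ht]
  exact h3.congr' hev

/-- Positions along the orbit of a good datum are continuous. [folklore] -/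
theorem continuous_flow_apply_fst (hG : G.IsHardSphereRegular ε) (hz : z ∈ good G ε)
    (i : Fin N) : Continuous fun s => (flow G ε s z i).1 := by
  have hπ : Continuous fun c : Config N d X => (c i).1 := by fun_prop
  rw [continuous_iff_continuousAt]
  intro t
  rw [continuousAt_iff_continuous_left'_right']
  constructor
  · rcases lt_or_ge 0 t with ht | ht
    · have h := (hπ.tendsto _).comp (tendsto_flow_nhdsLT_of_pos hG hz ht)
      have hval : (fwdFlowLeft G ε z t i).1 = (flow G ε t z i).1 := by
        rw [flow_of_nonneg ht.le, hz.2.2.1.fwdFlowLeft_apply_fst hG ht.le]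
      rw [hval] at h
      exact h
    · have h := (hπ.tendsto _).comp (tendsto_flow_nhdsLT_of_nonpos hG hz ht)
      have hval : (flipVel (fwdFlow G ε (flipVel z) (-t)) i).1 = (flow G ε t z i).1 := by
        rw [flow_of_nonpos hG hz ht, flipVel_apply, flipVel_apply]
        exact (hz.2.2.2.fwdFlowLeft_apply_fst hG (neg_nonneg.2 ht) i).symm
      rw [hval] at h
      exact h
  · rcases lt_or_ge t 0 with ht | ht
    · exact (hπ.tendsto _).comp (tendsto_flow_nhdsGT_of_neg hG hz ht)
    · exact (hπ.tendsto _).comp (tendsto_flow_nhdsGT_of_nonneg hG hz ht)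

/-- Free flight on collision-free windows `(s, t]` with `0 ≤ s`. [folklore] -/
theorem flow_free_of_nonneg (hG : G.IsHardSphereRegular ε) (hz : z ∈ good G ε) {s t : ℝ}
    (hs : 0 ≤ s) (hst : s ≤ t)
    (hfree : ∀ σ ∈ Ioc s t, σ ∉ collisionTimes G ε (fun u => flow G ε u z)) :
    flow G ε t z = freeFlight G (t - s) (flow G ε s z) := by
  rw [flow_of_nonneg hs, flow_of_nonneg (hs.trans hst)]
  refine hz.2.2.1.fwdFlow_eq_freeFlight_fwdFlow hs hst fun u hu huI => ?_
  exact hfree u huI ((mem_collisionTimes_flow_iff_of_pos hG hz (hs.trans_lt huI.1)).2 hu)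

/-- Free flight on collision-free windows `(s, t]` with `t ≤ 0`. [folklore] -/
theorem flow_free_of_nonpos (hG : G.IsHardSphereRegular ε) (hz : z ∈ good G ε) {s t : ℝ}
    (ht : t ≤ 0) (hst : s ≤ t)
    (hfree : ∀ σ ∈ Ioc s t, σ ∉ collisionTimes G ε (fun u => flow G ε u z)) :
    flow G ε t z = freeFlight G (t - s) (flow G ε s z) := by
  rw [flow_of_nonpos hG hz ht, flow_of_nonpos hG hz (hst.trans ht)]
  have h := hz.2.2.2.fwdFlowLeft_eq_freeFlight_fwdFlowLeft (a := -t) (b := -s)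
    (neg_nonneg.2 ht) (neg_le_neg hst) fun u hu huI => ?_
  · rw [h, show -s - -t = t - s by ring, freeFlight_flipVel_freeFlight]
  · refine hfree (-u) ⟨by linarith [huI.2], by linarith [huI.1]⟩ ?_
    refine (mem_collisionTimes_flow_iff_of_nonpos hG hz (by linarith [huI.1])).2 ?_
    rw [neg_neg]
    exact hu

/-- **Free flight on collision-free windows** for the orbit of a good datum. [folklore] -/
theorem flow_free (hG : G.IsHardSphereRegular ε) (hz : z ∈ good G ε) {s t : ℝ} (hst : s ≤ t)
    (hfree : ∀ σ ∈ Ioc s t, σ ∉ collisionTimes G ε (fun u => flow G ε u z)) :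
    flow G ε t z = freeFlight G (t - s) (flow G ε s z) := by
  rcases le_or_gt 0 s with hs | hs
  · exact flow_free_of_nonneg hG hz hs hst hfree
  rcases le_or_gt t 0 with ht | ht
  · exact flow_free_of_nonpos hG hz ht hst hfree
  · have h1 := flow_free_of_nonneg hG hz le_rfl ht.le fun σ hσ => hfree σ ⟨hs.trans hσ.1, hσ.2⟩
    have h2 := flow_free_of_nonpos hG hz le_rfl hs.le fun σ hσ =>
      hfree σ ⟨hσ.1, hσ.2.trans ht.le⟩
    rw [h1, h2, ← freeFlight_add]
    congr 1
    ring

/-- **Collisions along the orbit of a good datum are simple**: a single contact pair, an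
incoming left limit, and the elastic jump. [folklore] -/
theorem flow_binary (hG : G.IsHardSphereRegular ε) (hz : z ∈ good G ε) (t : ℝ) (i j : Fin N)
    (hij : i ≠ j) (hc : flow G ε t z ∈ contactSet G N ε i j) :
    (∀ i' j' : Fin N, i' ≠ j' → flow G ε t z ∈ contactSet G N ε i' j' →
      ({i', j'} : Finset (Fin N)) = {i, j}) ∧
    ∃ zl, Tendsto (fun s => flow G ε s z) (𝓝[<] t) (𝓝 zl) ∧ IsIncoming G zl i j ∧
      flow G ε t z = collidePair G i j zl := by
  rcases lt_or_ge 0 t with ht | ht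
  · have hI : t ∈ instantSet G ε z :=
      (mem_collisionTimes_flow_iff_of_pos hG hz ht).1 ⟨i, j, hij, hc⟩
    obtain ⟨p, hp, hjump⟩ := hz.2.2.1.exists_jump hG hI
    rw [flow_of_nonneg ht.le] at hc ⊢
    have hfst : ∀ k, (fwdFlow G ε z t k).1 = (fwdFlowLeft G ε z t k).1 := fun k => by
      rw [hjump, collidePair_apply_fst]
    have hcL : fwdFlowLeft G ε z t ∈ contactSet G N ε i j := (mem_contactSet_congr_fst hfst).1 hc
    refine ⟨fun i' j' hij' hc' => ?_, fwdFlowLeft G ε z t, tendsto_flow_nhdsLT_of_pos hG hz ht,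
      hp.isIncoming_of_mem_contactSet hG hij hcL, ?_⟩
    · rw [(hp.2.2 i' j' hij').1 ((mem_contactSet_congr_fst hfst).1 hc'), (hp.2.2 i j hij).1 hcL]
    · rw [hjump, hp.collidePair_eq hG (fun _ => rfl) hij hcL]
  · have hI : -t ∈ instantSet G ε (flipVel z) :=
      (mem_collisionTimes_flow_iff_of_nonpos hG hz ht).1 ⟨i, j, hij, hc⟩
    obtain ⟨p, hp, hjump⟩ := hz.2.2.2.exists_jump hG hI
    rw [flow_of_nonpos hG hz ht] at hc ⊢
    have hcL : fwdFlowLeft G ε (flipVel z) (-t) ∈ contactSet G N ε i j :=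
      (flipVel_mem_contactSet_iff _).1 hc
    refine ⟨fun i' j' hij' hc' => ?_, flipVel (fwdFlow G ε (flipVel z) (-t)),
      tendsto_flow_nhdsLT_of_nonpos hG hz ht, ?_, ?_⟩
    · rw [(hp.2.2 i' j' hij').1 ((flipVel_mem_contactSet_iff _).1 hc'), (hp.2.2 i j hij).1 hcL]
    · rw [isIncoming_flipVel_iff, hjump]
      exact hp.isOutgoing_collidePair hG hij hcL
    · rw [collidePair_flipVel hij, hjump,
        hp.collidePair_eq hG (fun k => collidePair_apply_fst _ k) hij hcL,
        collidePair_collidePair hp.ne]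

/-- **Orbits of good points are hard-sphere trajectories** (CIP 1994 §4.2 p. 65; GST 2013
§4.1, Def. 4.1.2), for the collision-by-collision flow `Kinetic.Alexander.flow` of any regular
geometry: `t ↦ T^t z` stays in the domain, has locally finitely many collision times,
continuous positions, is free flight between collisions and resolves each collision by the
elastic reflection of a single incoming pair. [cite: CIP1994, §4.2 p. 65] -/
theorem isHardSphereTrajectory_flow (hG : G.IsHardSphereRegular ε) (hz : z ∈ good G ε) :
    IsHardSphereTrajectory G ε N fun t => flow G ε t z where
  mem t := by
    show flow G ε t z ∈ hardSphereDomain G N ε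
    rcases le_or_gt 0 t with ht | ht
    · rw [flow_of_nonneg ht]
      exact hz.2.2.1.fwdFlow_mem ht
    · rw [flow_of_neg ht, flipVel_mem_hardSphereDomain_iff]
      exact hz.2.2.2.fwdFlowLeft_mem hG (neg_nonneg.2 ht.le)
  locFinite a b := finite_collisionTimes_flow_inter_Icc hG hz a b
  pos_continuous i := continuous_flow_apply_fst hG hz i
  free s t hst hfree := flow_free hG hz hst hfree
  binary t i j hij hc := flow_binary hG hz t i j hij hc

end Good

/-- **Discharge of `torusFlow_isTrajectory`**: on the flat torus with `0 < ε < 1/2` (a regular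
geometry, `Torus.isHardSphereRegular_geometry`) the orbits of good points of the constructed
flow are hard-sphere trajectories (CIP 1994 §4.2 p. 65; GST 2013 Def. 4.1.2). [cite: CIP1994, §4.2 p. 65] -/
theorem torusFlow_isTrajectory_holds : torusFlow_isTrajectory (d := d) :=
  fun _ε _hε hε' _N _z hz => isHardSphereTrajectory_flow (Torus.isHardSphereRegular_geometry hε') hz

end Alexander

end Kinetic

end

end Literature.Analysis.FluidPDE
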